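import Summits.QuantumFields.YangMills.Theorems.AllWindowsColdBoxBoxHighLineStep2Defs
import Summits.QuantumFields.YangMills.Theorems.AllWindowsColdBoxBoxHighLineGhostMSchur

/-!
# U5 ⟨stmt-QuantumFields-24336⟩ — lift L5 of U5-BLOCKERS.md (B5 «rarity entropy»): TYPED TASK PROPS (planner ym-idea-2 g18, 2026-08-29T22:3xZ)

Scope.  LINE-20 v4 (`Lines/landau_rung3.lean` d9a2874eadb019ee), active stub U5 `stub_landauThirdOrder` (window `θL < 1/10`).  U5-BLOCKERS §2
records that, with the landed rarity ✓`BoxToChart.exists_boxState_largeField_le` (normaliser entropy ⇒ `ε₁ > 2θ`, constraint (c)) and the landed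
T-S5.6 ✓`smallFieldInsideFP` (exponent `C·r·H⁵ − c·β·s²`, constraint (d) `6θ + ε₁ − 1/2 < 2κ₃`), Steps A–C of the S5 chain cap the window at
`θ < 5/64` (this is WHY LINE-19 S5 was re-cut to `5/64`, v13).  L5 = sharpen the exponent of T-S5.6 from `r·H⁵` to `r·H⁴·polylog`, which moves
the cap of Steps A–C to `θ < 5/58` ((c)+(d′)+(a): `7θ − 1/2 < 2κ₃ < (1 − 8θ)/3`); the full U5 window `1/10` needs IN ADDITION the entropy-free
rarity L5+ (U5-BLOCKERS §2, not typed here: design first) and the second→third-order lifts L1–L4.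

WHY `r·H⁵` AND HOW TO LOSE ONE `H` (the point of this file — the earlier wording «6a′ relative error C(t + t²H²)·Q» in U5-BLOCKERS ≤ f2130b4b083e
is WITHDRAWN: it is false pointwise for smooth low modes, where the cubic vertex `⟨da,[a,a]⟩ ≍ t·H·Q`).  In ✓6a `actionSandwich` the relative error
`C·t·H` comes from Cauchy–Schwarz between `Σ‖a_e‖² ≤ 344·H²·Q` (✓`sum_norm_sq_le_boxQuadForm`) and `Σ‖da‖² ≍ Q`; the domination step of T-S5.6
then pays the Gaussian normaliser ratio `((1+ρ)/(1−ρ))^{n/2} ≈ e^{ρ·n}`, `ρ = C·r·H`, `n = 3·#edges ≍ H⁴` ⇒ `e^{C·r·H⁵}`.  The sharp route keeps the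
edge-mass term SEPARATE instead of converting it to `Q` pointwise:
  (6a′) `|W + Φ − Q| ≤ C·t·(Q(a) + N(a))`, `N(a) := Σ_e ‖a_e‖²`, on `{‖a_e‖ ≤ t ≤ c₀}` — pointwise TRUE with NO factor `H`
  (cubic ≤ t·Σ|da|² + t·Σ_p|a|⁴/t·… by AM–GM with weight `ε = t`; quartic and the BCH/`Φ` corrections likewise);
  (T-S5.6′) dominate `e^{−β(W+Φ)}` on the `r`-ball by the two Gaussians with forms `Q_∓ := (1 ∓ C r)·Q ∓ C r·N` (positive definite as long as
  `C r·344H² < 1/2`, i.e. the EXISTING hypothesis `r·H² ≤ c₀`); their normaliser ratio is `exp(O(r·(n + β·E_Q[β N]))) = exp(O(r·(n + Σ_e G(e,e))))`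
  with `G = (hodgeQ H)⁻¹`, and `Σ_e G(e,e) ≤ C·n` is EXACTLY the landed S3 ✓`LandauVarianceBounded` (`(hodgeQ H)⁻¹ e e ≤ C`); the ghost/Haar
  factors contribute `exp(C·r²·H⁴·(1+log H))` through the no-linear-term ghost Taylor ✓7d `ghostTaylor` + ✓`GhostFP.abs_quadVal_ghostM_le`
  (= L5 (ii) `GhostMOpNorm`, ALREADY LANDED by w3 g40: `GhostFP.sum_abs_ghostM_le`, `…GhostMSchur.lean`) and ✓7c `haarTaylor`.
  Net exponent: `C·r·H⁴·(1 + log H) − c·β·s²` (the `log` absorbs the ghost quadratic term and is harmless in the β-exponent arithmetic).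

CONSTRAINT ARITHMETIC after L5 (for the record; all strict, constant-free in the β-exponent — critic N2): with `r ≍ β^{θ+ε₁−1/2}·polylog`
(S4b ✓`landauRepresentative`: `r₀ = C·H(1+log H)²·spl`, `spl = β^{ε₁−1/2}`), `s = β^{−1/2+κ₃}`, `H ≍ β^θ`:
`r·H⁴ ≪ β·s²` ⟺ (d′) `5θ + ε₁ − 1/2 < 2κ₃`; with (c) `ε₁ > 2θ` and (a) `κ₃ < (1/2 − 4θ)/3`: feasible iff `θ < 5/58`; WITHOUT (c) (after L5+):
(d′) is implied by `ε₁ ↓ κ₃` for every `θ < 1/10`.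

This file: TWO task Props (6a′, T-S5.6′) with binders copied from ✓`ActionSandwich` / ✓`SmallFieldInsideFP` (`…Step2Defs`), the by-name record
that L5 (ii) is landed, and the trivial monotonicity `SmallFieldInsideFPSharp → SmallFieldInsideFP`-direction is NOT claimed (the sharp Prop has the
weaker exponent only for `r·H ≥ 1`-type regimes; both are stated independently).  Typed statements only — NO proofs of 6a′/T-S5.6′ here.
Natural owners (bus 22:06:13Z): 6a′ → the 6a lineage (w2), T-S5.6′ → the T-S5.6 lineage (w4).  Sizes: 6a′ S/M (the 6a proof with one AM–GM
changed); T-S5.6′ M (the T-S5.6 proof with the two-form Gaussians `Q_∓` and S3 for the trace).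

HONEST LABEL: task statements for an UNSTAFFED stub (U5) of a critic-PASSed DRAFT line; nothing is proved here; U5, ⟨24336⟩, ⟨24004⟩ OPEN;
route AllWindowsColdBox DRAFT by design; **the Yang–Mills mass gap is NOT proved; no summit is proved by a line.**
-/

open MeasureTheory Matrix Finset Real

noncomputable section

namespace Summit.QuantumFields.YangMills.Theorems.AllWindowsColdBoxBoxHighLine

/-- The edge mass `N(a) = Σ_e ‖a_e‖²` (kept separate from `boxQuadForm` in the sharp sandwich). -/
def edgeMass (H : ℕ) (a : LandauFree H → E3) : ℝ := ∑ e : LandauFree H, ‖a e‖ ^ 2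

/-- **U5-L5 (i) = T-S5.6a′ `ActionSandwichSharp`** — on fields with all `‖a_e‖ ≤ t ≤ c₀`:
`|S(U(a)) + Φ(U(a)) − boxQuadForm H a| ≤ C·t·(boxQuadForm H a + Σ_e ‖a_e‖²)` — NO factor `H` (compare ✓`ActionSandwich`: `C·t·H·boxQuadForm`,
hypothesis `t·H ≤ c₀`).  The two are incomparable pointwise; T-S5.6′ consumes this one. -/
def ActionSandwichSharp : Prop :=
  ∃ C c₀ : ℝ, 0 < c₀ ∧ ∀ H : ℕ, 1 ≤ H → ∀ t : ℝ, 0 ≤ t → t ≤ c₀ → ∀ a : LandauFree H → E3, (∀ e, ‖a e‖ ≤ t) →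
    |boxWilson H (edgeChart H a) + landauPhi H (edgeChart H a) - boxQuadForm H a| ≤ C * t * (boxQuadForm H a + edgeMass H a)

/-- **U5-L5 (iii) = T-S5.6′ `SmallFieldInsideFPSharp`** — same binders as ✓`SmallFieldInsideFP` (`H ≥ 1`, `β ≥ 1`, `0 < s`, `4s ≤ r`, `r·H² ≤ c₀`,
`C(1 + log H) ≤ β s²`), sharper exponent: `∫_{chartDomain ∖ smallField s} w_J ≤ C·H⁴·exp(C·r·H⁴·(1 + log H) − c·β·s²) · ∫_{smallField (s/2)} w_J`.
Route: 6a′ two-form domination `Q_∓ = (1 ∓ C r)Q ∓ C r·N`, normaliser ratio via `Σ_e (hodgeQ H)⁻¹ e e ≤ C·#edges` (S3 ✓`LandauVarianceBounded`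
by name: ✓`landauKernelBounds.1`), ghost factor via ✓`ghostTaylor` + ✓`GhostFP.abs_quadVal_ghostM_le`, Haar via ✓`haarTaylor`. -/
def SmallFieldInsideFPSharp : Prop :=
  ∃ C c c₀ : ℝ, 0 < c ∧ 0 < c₀ ∧ ∀ H : ℕ, 1 ≤ H → ∀ β r s : ℝ, 1 ≤ β → 0 < s → 4 * s ≤ r → r * (H : ℝ) ^ 2 ≤ c₀ →
    C * (1 + Real.log H) ≤ β * s ^ 2 →
    ∫ a in chartDomain H \ smallField H s, fpChartWeight β H r a ≤
      C * (H : ℝ) ^ 4 * Real.exp (C * r * (H : ℝ) ^ 4 * (1 + Real.log H) - c * β * s ^ 2) *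
        ∫ a in smallField H (s / 2), fpChartWeight β H r a

/-- **U5-L5 (ii) `GhostMOpNorm` is LANDED** (w3 g40, `…GhostMSchur`): the Schur row-sum bound on the ghost quadratic form, recorded by name. -/
theorem ghostMOpNorm_landed : ∃ C : ℝ, 0 ≤ C ∧ ∀ H : ℕ, 1 ≤ H → ∀ i : LandauFree H × Fin 3,
    ∑ j : LandauFree H × Fin 3, |GhostFP.ghostM H i j| ≤ C * (1 + Real.log H) :=
  GhostFP.sum_abs_ghostM_le

/-- Sanity: `edgeMass` is nonnegative. -/
theorem edgeMass_nonneg (H : ℕ) (a : LandauFree H → E3) : 0 ≤ edgeMass H a :=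
  Finset.sum_nonneg fun _ _ => by positivity

end Summit.QuantumFields.YangMills.Theorems.AllWindowsColdBoxBoxHighLine

end
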